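import Summits.Ventures.PercRepro.C041ZoneOCubeDefs
import Summits.Ventures.PercRepro.C041CSCount

/-!
# The ZONE (CS) conjecture — mine-3's sharpened target for the ZONE O-CUBE (C-041.md §16–§17 (d)) (p6, gen 28)

Setting of `C041ZoneOCubeDefs`.  On an abstract zone with anchors `A` and protected anchors `Q`, the three COUNTS
over the admissible states with `Γ` — `nValid` (valid), `nG1` (`G1`), `nG2` (`G2`) — and CONJECTURE (ZONE CS):
`(#valid − #G₁ − #G₂)₊² ≤ #G₁ · #G₂` (`ZoneCSConj`; `ZoneCSConjF` with forced edges).  The ZONE O-CUBE sum is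
`3·#G₁ + 3·#G₂ − 2·#valid` (`zoneOCube_eq_counts`, `zoneOCubeF_eq_counts`), so the ZONE (CS) implies the ZONE
O-CUBE by AM–GM (`zoneOCubeConj_of_zoneCS`, `zoneOCubeConjF_of_zoneCSF`) — mine-3's «(CS) IMPLIES (G⅔)» at the
zone level.  NOT claimed: the conjecture itself (census C-041.md §15 (b): 157 + 148 zones, 0 violations, 9 tight).
-/

namespace PercRepro

namespace ZoneZ

open Finset CSCount

namespace ZoneData

variable {V E T₁ T₂ : Type*} (Z : ZoneData V E T₁ T₂) (A : Set V)
variable [Fintype E] [DecidableEq E] [Fintype T₁] [DecidableEq T₁] [Fintype T₂] [DecidableEq T₂] (Q : Set V)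

open Classical in
/-- The valid admissible states (with `Γ`). -/
noncomputable def nValid : ℕ := #((Z.Aset Q).filter fun σ => Z.Valid A σ)

open Classical in
/-- The admissible states with `G1` (with `Γ`). -/
noncomputable def nG1 : ℕ := #((Z.Aset Q).filter fun σ => Z.G1 A σ)

open Classical in
/-- The admissible states with `G2` (with `Γ`). -/
noncomputable def nG2 : ℕ := #((Z.Aset Q).filter fun σ => Z.G2 A σ)

/-- **mine-3's CONJECTURE (ZONE CS)** (C-041.md §16–§17 (d)): `(#valid − #G₁ − #G₂)₊² ≤ #G₁ · #G₂` over the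
admissible states of a zone.  NOT asserted. -/
def ZoneCSConj : Prop := CS (Z.nValid A Q) (Z.nG1 A Q) (Z.nG2 A Q)

open Classical in
/-- **The ZONE O-CUBE sum through the counts**: `zoneOCube = 3·#G₁ + 3·#G₂ − 2·#valid`. -/
theorem zoneOCube_eq_counts : Z.zoneOCube A Q = 3 * (Z.nG1 A Q : ℤ) + 3 * Z.nG2 A Q - 2 * Z.nValid A Q := by
  unfold zoneOCube nG1 nG2 nValid
  rw [Finset.sum_congr rfl fun σ _ => Z.ocWeight_eq A σ, Finset.sum_sub_distrib, Finset.sum_add_distrib,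
    ← Finset.mul_sum, ← Finset.mul_sum, ← Finset.mul_sum, Finset.sum_boole, Finset.sum_boole, Finset.sum_boole]

/-- **The ZONE (CS) implies the ZONE O-CUBE** (AM–GM). -/
theorem zoneOCubeConj_of_zoneCS (h : Z.ZoneCSConj A Q) : Z.ZoneOCubeConj A Q := by
  unfold ZoneOCubeConj
  rw [zoneOCube_eq_counts]
  have := two_mul_le_of_cs h
  omega

end ZoneData

namespace FZone

variable {V E T₁ T₂ : Type*} (F : FZone V E T₁ T₂) (A : Set V)
variable [Fintype E] [DecidableEq E] [Fintype T₁] [DecidableEq T₁] [Fintype T₂] [DecidableEq T₂] (Q : Set V)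

open Classical in
/-- The forced valid admissible states (with `Γ`). -/
noncomputable def nValidF : ℕ := #((F.AsetF Q).filter fun σ => F.Valid A σ)

open Classical in
/-- The forced admissible states with `G1` (with `Γ`). -/
noncomputable def nG1F : ℕ := #((F.AsetF Q).filter fun σ => F.G1 A σ)

open Classical in
/-- The forced admissible states with `G2` (with `Γ`). -/
noncomputable def nG2F : ℕ := #((F.AsetF Q).filter fun σ => F.G2 A σ)

/-- **CONJECTURE (ZONE CS) with forced edges.**  NOT asserted. -/
def ZoneCSConjF : Prop := CS (F.nValidF A Q) (F.nG1F A Q) (F.nG2F A Q)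

open Classical in
/-- **The ZONE O-CUBE sum with forced edges through the counts.** -/
theorem zoneOCubeF_eq_counts :
    F.zoneOCubeF A Q = 3 * (F.nG1F A Q : ℤ) + 3 * F.nG2F A Q - 2 * F.nValidF A Q := by
  unfold zoneOCubeF nG1F nG2F nValidF
  rw [Finset.sum_congr rfl fun σ _ => F.ocWeight_eq A σ, Finset.sum_sub_distrib, Finset.sum_add_distrib,
    ← Finset.mul_sum, ← Finset.mul_sum, ← Finset.mul_sum, Finset.sum_boole, Finset.sum_boole, Finset.sum_boole]

/-- **The ZONE (CS) with forced edges implies the ZONE O-CUBE with forced edges** (AM–GM). -/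
theorem zoneOCubeConjF_of_zoneCSF (h : F.ZoneCSConjF A Q) : F.ZoneOCubeConjF A Q := by
  unfold ZoneOCubeConjF
  rw [zoneOCubeF_eq_counts]
  have := two_mul_le_of_cs h
  omega

end FZone

end ZoneZ

end PercRepro
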